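import Literature.Topology.FourManifolds.SPC4HandlesLeaves
import HarnessLib

/-!
# h₃ of Laudenbach–Poénaru's extension theorem from the two current leaves of its proof DAG

Topic `Literature/Topology/FourManifolds`; fact seat
`provefact-Literature.Topology.FourManifolds.exists_diffeoExtends_isOrientationReversing` on the
named fact **h₃** `Literature.Topology.FourManifolds.exists_diffeoExtends_isOrientationReversing`
(`SPC4HandlesProofs.lean`): *the boundary of every compact connected orientable `4`-dimensional
`1`-handlebody `V` carries an orientation-reversing self-diffeomorphism which extends over `V`,
fixes a point `z₀` and induces the identity of `π₁(∂V, z₀)`* (the reflection of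
`♮k S¹ × B³ ⊂ ℝ⁴` in a hyperplane through the cores; Laudenbach–Poénaru, Bull. SMF 100 (1972),
§2, p. 342, diagram (5), there on the `X_p` side).

This file only **assembles**.  The tree proves h₃ on the mirror-symmetric models
`{q(x, y) + z² + w² ≤ c} ⊂ ℝ⁴` in every universe (SYMMᴹ,
`exists_oneHandlebody_diffeoExtends_isOrientationReversing_holds`, `SPC4HandlesSymmHolds.lean`)
and transports it to an arbitrary `V` through the normal form NORM
(`exists_hasHandleDecomposition_handleCount_one`) and the classification UNIQ₄
(`nonempty_diffeomorph_of_hasHandleDecomposition_handleCount_one`):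
`exists_diffeoExtends_isOrientationReversing_of_norm_of_uniq`.  Composing with the proved
reductions of NORM (`exists_hasHandleDecomposition_handleCount_one_of_firstCancellation`,
`…_of_modelChart`, `SPC4HandlesCancelStepProofs.lean`) and of UNIQ₄
(`nonempty_diffeomorph_of_hasHandleDecomposition_handleCount_one_of_oneHandle`,
`SPC4HandlesLeaves.lean`: the `0`-handle is a disc by `MorseDiscLemma.lean`), h₃ is a
consequence of exactly **two leaves that are still named facts**:

| leaf | source | tree name |
|---|---|---|
| L1, uniqueness of attaching one `1`-handle | Kosinski (1993), VI (6.6), (11.4)(c) | `oneHandle_nonempty_diffeomorph` |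
| Assertion 6 of Thm. 5.4, the chart `ḡ` | Milnor (1965), proof of Thm. 5.4 (PDF pp. 30–32) | `Cobordism.Milnor1965_cancellation_modelChart` |

(the second through Thm. 5.4 on a slab, `Cobordism.Milnor1965_firstCancellation_slab`, by
`Cobordism.Milnor1965_firstCancellation_slab_of_modelChart`).  Main statements:
`exists_diffeoExtends_isOrientationReversing_of_norm_of_oneHandle` (NORM + L1),
`exists_diffeoExtends_isOrientationReversing_of_firstCancellation_of_oneHandle` (Thm. 5.4 + L1),
`exists_diffeoExtends_isOrientationReversing_of_leaves` (Assertion 6 + L1).  Once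
`oneHandle_nonempty_diffeomorph_holds` and `Cobordism.Milnor1965_cancellation_modelChart_holds`
have landed, the discharge `exists_diffeoExtends_isOrientationReversing_holds` is
`exists_diffeoExtends_isOrientationReversing_of_leaves` applied to them.  Nothing is asserted
here; no definition and no named fact is introduced.

## References

* F. Laudenbach, V. Poénaru, *A note on 4-dimensional handlebodies*, Bull. Soc. Math. France
  100 (1972), 337–344, §2, p. 342, diagram (5). [LaudenbachPoenaruBSMF1972]
* A. A. Kosinski, *Differential Manifolds* (1993), VI (6.6), §11, (11.4)(c). [Kosinski1993]
* J. Milnor, *Lectures on the h-cobordism theorem* (1965), Thm. 5.4 and its proof, Assertion 6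
  (PDF pp. 30–32); proof of Thm. 8.1 Index 0. [MilnorHCobordism1965]
* A. Juhász, *Differential and Low-Dimensional Topology* (2023), §6.1. [Juhasz2023]
-/

open scoped Manifold ContDiff Topology
open Set Function

noncomputable section

namespace Literature.Topology.FourManifolds

universe u

/-- **h₃ from NORM and L1.**  An orientation-reversing, `π₁`-trivial, extendable
self-diffeomorphism of the boundary of every compact connected orientable `4`-dimensional
`1`-handlebody (`exists_diffeoExtends_isOrientationReversing`), granted the normal form NORM
(`exists_hasHandleDecomposition_handleCount_one`: one `0`-handle, `k` `1`-handles) and the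
uniqueness of attaching one `1`-handle L1 (`oneHandle_nonempty_diffeomorph`, which gives the
classification UNIQ₄ by `nonempty_diffeomorph_of_hasHandleDecomposition_handleCount_one_of_oneHandle`):
by `exists_diffeoExtends_isOrientationReversing_of_norm_of_uniq` (SYMMᴹ discharged).
Laudenbach–Poénaru (1972), §2, p. 342 with Kosinski (1993), VI (11.4)(c).
[cite: LaudenbachPoenaruBSMF1972, §2, p. 342, diagram (5)] [cite: Kosinski1993, VI (11.4)(c)] -/
theorem exists_diffeoExtends_isOrientationReversing_of_norm_of_oneHandle
    (hN : exists_hasHandleDecomposition_handleCount_one.{u})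
    (h₁ : oneHandle_nonempty_diffeomorph.{u}) :
    exists_diffeoExtends_isOrientationReversing.{u} :=
  exists_diffeoExtends_isOrientationReversing_of_norm_of_uniq hN
    (nonempty_diffeomorph_of_hasHandleDecomposition_handleCount_one_of_oneHandle h₁)

/-- **h₃ from Milnor's First Cancellation Theorem 5.4 on a slab and L1**: NORM follows from
Thm. 5.4 on a slab (`Cobordism.Milnor1965_firstCancellation_slab`) by
`exists_hasHandleDecomposition_handleCount_one_of_firstCancellation` (Juhász (2023), §6.1;
Milnor (1965), proof of Thm. 8.1 Index 0), whence h₃ by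
`exists_diffeoExtends_isOrientationReversing_of_norm_of_oneHandle`.
[cite: MilnorHCobordism1965, Thm. 5.4 and proof of Thm. 8.1 Index 0]
[cite: Kosinski1993, VI (11.4)(c)] -/
theorem exists_diffeoExtends_isOrientationReversing_of_firstCancellation_of_oneHandle
    (h54 : Cobordism.Milnor1965_firstCancellation_slab.{u})
    (h₁ : oneHandle_nonempty_diffeomorph.{u}) :
    exists_diffeoExtends_isOrientationReversing.{u} :=
  exists_diffeoExtends_isOrientationReversing_of_norm_of_oneHandle
    (exists_hasHandleDecomposition_handleCount_one_of_firstCancellation h54) h₁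

/-- **h₃ from the two current leaves of its proof DAG**: the chart construction of Assertion 6
of the First Cancellation Theorem (`Cobordism.Milnor1965_cancellation_modelChart`, Milnor
(1965), proof of Thm. 5.4, PDF pp. 30–32; it gives Thm. 5.4 on a slab by
`Cobordism.Milnor1965_firstCancellation_slab_of_modelChart`, hence NORM by
`exists_hasHandleDecomposition_handleCount_one_of_modelChart`) and the uniqueness of attaching
one `1`-handle L1 (`oneHandle_nonempty_diffeomorph`, Kosinski (1993), VI (6.6), (11.4)(c)).
The discharge `exists_diffeoExtends_isOrientationReversing_holds` is this theorem applied to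
the discharges of the two leaves.
[cite: MilnorHCobordism1965, proof of Thm. 5.4, Assertion 6 (PDF pp. 30–32)]
[cite: Kosinski1993, VI (6.6), (11.4)(c)] -/
theorem exists_diffeoExtends_isOrientationReversing_of_leaves
    (hE : Cobordism.Milnor1965_cancellation_modelChart.{u})
    (h₁ : oneHandle_nonempty_diffeomorph.{u}) :
    exists_diffeoExtends_isOrientationReversing.{u} :=
  exists_diffeoExtends_isOrientationReversing_of_norm_of_oneHandle
    (exists_hasHandleDecomposition_handleCount_one_of_modelChart hE) h₁

end Literature.Topology.FourManifolds
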